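import Literature.AlgebraicGeometry.Resolution.InseparableLocalUniformizationLemmas
import Literature.AlgebraicGeometry.Resolution.InseparableLocalUniformizationDescentStepZero
import HarnessLib

/-!
# Inseparable local uniformization: Steps 3–4 of the proof of Thm. 4.1.1 (the common engine of §4)

**STATUS (verdict clean-up, 2026-08-16): the single named fact of this file,
`Temkin2013_Steps34`, is DEPRECATED — MIS-RENDERED, superseded by the corrected rendering
`Temkin2013_Steps34_tower` (`InseparableLocalUniformizationEngineTower.lean`), which is PROVED:
`Temkin2013_Steps34_tower_holds` (`InseparableLocalUniformizationStepsThreeFourHolds.lean`).**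
*What is wrong:* the binders `∀ (K₁ : Type u) [Field K₁] [Algebra K K₁] [Algebra k̄ K₁]
[IsScalarTower k̄ K K₁]` (with `k̄ = kb : IntermediateField k K`) do not say what they were
meant to say. The tower binder elaborates against the `k̄`-action on `K₁` INHERITED from `K`
(`IntermediateField.instSMulSubtypeMem`; checked 2026-08-16: in that binder context
`h : IsScalarTower kb K K₁` has type `@IsScalarTower kb K K₁ kb.instSMulSubtypeMem _
kb.instSMulSubtypeMem` and is found by `inferInstance`, while `algebraMap kb K₁ c = algebraMap K
K₁ c` fails), so it is automatically true and does NOT constrain the separate binder instance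
`Algebra k̄ K₁`, which is the structure the hypotheses `hXS`, `hSE` (`etaModel k̄ …`,
`etaModelBaseMap …`) actually use. The fact therefore quantifies over an ARBITRARY field
embedding `ι : k̄ → K₁` — its hypotheses speak of `Nr_{K₁}(Nr_{K₁}(A)·ι(k̄°))` and of
smooth-equivalence over `ι(k̄°)` — whereas in the source `k̄ ⊆ K ⊆ K₁` are extensions of valued
fields (proof of Thm. 4.1.1, Step 1: "a valued subfield `k̄ ↪ K` … the embedding `k̄ ↪ K`
induces a morphism `X → Y`"; `Kᵢ/K` finite valued extensions) and Steps 3–4 (refine `Y`, form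
`X_α = Nr_η(X ×_Y Y_α)` INSIDE `K`, apply Thm. 4.1.1 to `Y`, extend `k̄ ⊆ K ⊆ K₁` purely
inseparably, Lemma 2.8.5, descent of smoothness) use that `ι` is the inclusion. For a wild `ι`
the printed argument does not apply, so `Temkin2013_Steps34` is STRONGER than what the paper
proves there and cannot be discharged along the printed lines (audit first recorded as ledger
p14842; prove-seat verdict "misstated", 2026-08-16). The statement is KEPT VERBATIM under its
ledger-referenced name (its in-tree users — `InseparableLocalUniformizationDefectStep.lean`,
`…HeightStepTwo.lean`, `…HeightInduction.lean`, `…Frontier.lean`, and the bridge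
`Temkin2013_Steps34.tower : Temkin2013_Steps34 → Temkin2013_Steps34_tower` of
`…EngineTower.lean` — only ever instantiate `ι` with the inherited structure; each has an
unconditional or `_tower` counterpart in `…DefectStepTower.lean`, `…HeightStepTwoTower.lean`,
`…HeightInductionTower.lean`, `…StepsThreeFourHolds.lean`, `…HeightStepFinal.lean`,
`…DefectStepFrontier.lean`, `…HeightLeOneFrontier.lean`), and carries the `deprecated`
attribute in text form because the replacement is declared downstream of this file. New work
takes `Temkin2013_Steps34_tower_holds`. The dictionary below is that of BOTH renderings (the
corrected one differs only in letting `k̄` act on `K₁` through `K`).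

Topic: `Literature/AlgebraicGeometry/Resolution`. M. Temkin, *Inseparable local uniformization*,
J. Algebra 373 (2013) 65–119 = arXiv:0804.1554v3 (numbering of this version; in the 41-pp. copy
held in the literature store Lemmas 2.8.4/2.8.5 are 2.7.4/2.7.5 and Steps 1–4 of the proof of
Thm. 4.1.1 are on pp. 29–30). Both remaining packaged steps
of the proof of the corrected Thm. 1.3.2 end with the SAME argument:

* proof of Thm. 4.1.1 (induction on the transcendence defect), Steps 3–4 (pp. 48–49), starting
  from diagram (2): "`zᵢ ∈ Cᵢ := Nr_{Kᵢ}(C)` … smooth-equivalent to the closed point `sᵢ` of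
  `Sᵢ := Spec(mᵢ°)`" over `S = Spec(k̄°)`, where `C = Nr_K(X ×_Y S)`;
* §4.2 (induction on the height), Step 2 (p. 51), after Lemma 3.3.2 and the refinement
  `X′ → X`: "So, refining `X` we can achieve that `X′_S →~ X_S` … Following the argument from
  Step 3 in §4.1, we deduce from Lemma 2.8.4 that refining `Y` via `Y′ → Y` and updating `X` as
  `Nr_η(Y′ ×_Y X)` we can achieve that `K°` is centered on a point `z ∈ X` which is
  smooth-equivalent to the center `y_m` of `m°` on `Y_m := Nr_m(Y)`. By Theorem 4.1.1 applied to
  `Y`, `k̄°` and `m°` … it also follows from Lemma 2.8.5 that the center of `K°` on `X` is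
  smooth-equivalent to `y_m`. So, the center of `K°` on `X` is `l`-smooth, and enlarging `l` we
  can even make it a simple `l`-smooth point."

This file vendors that common argument — for ONE valued extension `K₁/K` (`n = 1`) and without
logarithmic data — as a NAMED FACT `Temkin2013_Steps34` in the affine vocabulary of the companion
files (`etaModel`, `AreSmoothEquivalent`, `Temkin2013DescentFor`, `Temkin2013DescentConclusion`),
so that

* `Temkin2013HeightStepOfDescent` can be PROVED from `Temkin2013Descent`, `Temkin2013_Lemma332`
  and `Temkin2013_Steps34` (Steps 0–2 of §4.2 being formalized), and
* `Temkin2013DescentDefectStep` from `Temkin2013RelativeCurve` (Thm. 3.3.1) and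
  `Temkin2013_Steps34` (Steps 0–2 of §4.1),

while `Temkin2013_Steps34` itself was to be PROVED from the printed inputs of Steps 3–4 in a
later file — a programme since CARRIED OUT for the corrected rendering
(`descentConclusionWeak_of_steps34Data`, `InseparableLocalUniformizationStepsThreeFourWeak.lean`,
and `Temkin2013DescentConclusion.of_weak`, `InseparableLocalUniformizationSimplePoint.lean`,
composed in `Temkin2013_Steps34_tower_holds`): `Temkin2013_Lemma284` (DISCHARGED: `Temkin2013_Lemma284_holds`,
`InseparableLocalUniformizationLemmasProofs.lean`), Lemma 2.8.5 in its corrected rendering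
`Temkin2013_Lemma285_normal` (`SmoothEquivalenceNormalization.lean` — NOT the first rendering
`Temkin2013_Lemma285`, which omits the tacit normality of `X`, `Y` and is refuted there,
`not_temkin2013_Lemma285`; normality holds where Step 4 applies the lemma: `X_{i,α} =
Nr_{Kᵢ}(X_α)`, `Y_{i,α} = Nr_{mᵢ}(Y_α)`), `Stacks05B5`, and `Temkin2013_valuationRingOpen`
(DISCHARGED: `Temkin2013_valuationRingOpen_holds`, `ValuationRingOpenInNormalizationProofs.lean`);
plus finiteness of `Nr_{K₁}(X)` over `X` (`NoetherFiniteIntegralClosure_holds`) to present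
`C₁ = Nr_{K₁}(C)` as the `η`-normalized base change of the normal model `X₁ = Nr_{K₁}(X)`, and
the "simple" enlargement of `l` at the very end (p. 49: "replacing `l` with a purely inseparable
extension, we can also arrange that `x₁` is a simple `l`-smooth point"). The printed
argument: refine `Y` through the filtered family of its affine refinements `Y_α` and pass to `X_α = Nr_η(X ×_Y Y_α)`, `X_{1,α} = Nr_{K₁}(X_α)`,
`Y_{1,α} = Nr_{m}(Y_α)` (Prop. 2.3.8 (i): `C₁ = lim X_{1,α}`, `Nr_m(S) = lim Y_{1,α}`, `S₁` open
in `Nr_m(S)`); Lemma 2.8.4 gives `α` with `x_{1,α}` smooth-equivalent to `y_{1,α}` over `Y_α`;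
Thm. 4.1.1 (for `Y`, `k̄°`, `m°`, available by the respective induction hypothesis — here a
HYPOTHESIS of the fact, `Temkin2013DescentFor k k̄ k̄°`) smoothens `y₁` after refining `Y` and
extending `k`, `k̄`, `m`, `K`, `K₁` purely inseparably (Lemma 2.8.5); descent of smoothness along
the smooth cover makes `x₁` `l`-smooth, and a further purely inseparable extension of `l` makes
it simple.

## Sources

* M. Temkin, *Inseparable local uniformization*, arXiv:0804.1554v3, proof of Thm. 4.1.1, Steps
  3–4 and Remark 4.1.3 (pp. 48–49); §4.2, Step 2 (p. 51).

## Rendering notes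

* Ground data: `k ⊆ O = K°`; the fibration base `k̄` is an intermediate field of `K/k`, finitely
  generated over `k`, with `k̄° = K° ∩ k̄` of height `≤ 1` (height one in the paper; `≤ 1` is
  what Thm. 4.1.1 needs) — `Ok̄ = O.comap (algebraMap k̄ K)`; "Thm. 4.1.1 applies to `Y`" is the
  hypothesis `Temkin2013DescentFor k k̄ Ok̄`; `Y = Spec B` is an affine `k`-model of `k̄°` inside
  `k̄` with `B ⊆ X = Spec A`, `A` a NORMAL affine model of `K°` ("`X_α` is a normalized `k`-model
  of `K°`"); `(K₁, K₁°)/(K, K°)` finite; `(m, m°)/(k̄, k̄°)` finite ("`m₁/l` finite separable" has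
  `l = k̄` after Step 2; separability of `m/k̄` is not used by Steps 3–4 and not assumed).
* `C₁ = Nr_{K₁}(C) = Nr_{K₁}(X ×_Y S)` is `etaModel k̄ (Nr_{K₁}(A)) k̄°` — the `η`-normalized
  base change to `S = Spec k̄°` of `X₁ = Nr_{K₁}(X)` (`nrIn` of the image of `A` in `K₁`), whose
  generic fibre `k̄[Nr_{K₁}(A)]` is integrally closed in `K₁`; `z₁` is the centre of `K₁°` on it;
  the hypothesis is the smooth-equivalence over `k̄°` of `(C₁, z₁)` with `(Spec m°, 𝔪_{m°})`
  (diagram (2), p. 48; in §4.2: Lemma 3.3.2's conclusion after "`X′_S →~ X_S`").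
* Conclusion: `Temkin2013DescentConclusion k K O A K₁ O₁`, the conclusion of Thm. 4.1.1 (`n = 1`,
  non-log) for this `X` and `(K₁, K₁°)` (it only speaks about `x₁ ∈ X₁ = Nr_{L₁}(X′)`).
-/

noncomputable section

namespace Literature.AlgebraicGeometry.Resolution

universe u

/-- **Deprecated** (2026-08-16) — **MIS-RENDERED**; superseded by the corrected rendering
`Temkin2013_Steps34_tower` of `InseparableLocalUniformizationEngineTower.lean` (declared
downstream of this file, whence the text form of the attribute), which is PROVED:
`Temkin2013_Steps34_tower_holds` (`InseparableLocalUniformizationStepsThreeFourHolds.lean`).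
*What is wrong:* in the binders `∀ (K₁ : Type u) [Field K₁] [Algebra K K₁] [Algebra kb K₁]
[IsScalarTower kb K K₁]` below, the tower hypothesis elaborates against the `kb`-action on `K₁`
inherited from `K` (`IntermediateField.instSMulSubtypeMem`), for which it holds automatically,
and so leaves the binder instance `Algebra kb K₁` — the structure through which `etaModel kb …`
and `etaModelBaseMap …` in `hXS`, `hSE` see `kb° ⊆ kb → K₁` — an ARBITRARY field embedding
`ι : kb → K₁`; the statement thus asserts the conclusion of Steps 3–4 for data
`Nr_{K₁}(Nr_{K₁}(A)·ι(kb°))` and smooth-equivalence over `ι(kb°)` for every `ι`, which is not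
what the source proves (there `k̄ ⊆ K ⊆ K₁` are valued field extensions and the argument —
refining `Y` inside `k̄ ⊆ K`, Thm. 4.1.1 for `Y`, purely inseparable extension of `k̄ ⊆ K ⊆ K₁`,
Lemma 2.8.5 — needs `ι` to be the inclusion; proof of Thm. 4.1.1, Step 1: "the embedding
`k̄ ↪ K` induces a morphism `X → Y`"). The corrected rendering drops the two binders, so that
`kb` acts on `K₁` through `K`; the bridge `Temkin2013_Steps34.tower : Temkin2013_Steps34 →
Temkin2013_Steps34_tower` (`…EngineTower.lean`) records that the correction only specialises.
Statement KEPT VERBATIM under its ledger-referenced name for its remaining in-tree users (module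
docstring); new work uses `Temkin2013_Steps34_tower_holds`. *Original content* —
NAMED FACT — **Steps 3–4 of the proof of Temkin's Thm. 4.1.1, the engine common to §4.1 and
§4.2** (Temkin 2013, pp. 48–49: Step 3 "Refine `Y` and replace the other entries of diagram (3)
with the `η`-normalized base changes so that `xᵢ` and `yᵢ` become smooth-equivalent. … by Lemma
2.8.4 there exists `α` such that the points `x_{i,α}` and `y_{i,α}` are smooth-equivalent over
`Y_α`"; Step 4 "Smoothen the points `yᵢ` by an additional refining of `Y` and a purely
inseparable extension of `k`. … the induction assumption applies to the scheme `Y` and the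
extensions `mᵢ/k̄` of valued fields. … `xᵢ` are still smooth-equivalent to `yᵢ` by Lemma 2.8.5
… In particular, `x₁` is `l`-smooth, and, replacing `l` with a purely inseparable extension, we
can also arrange that `x₁` is a simple `l`-smooth point"; re-used in §4.2, Step 2, p. 51:
"Following the argument from Step 3 in §4.1 … By Theorem 4.1.1 applied to `Y`, `k̄°` and `m°` …
Lemma 2.8.5 … enlarging `l` we can even make it a simple `l`-smooth point"), vendored for `n = 1`
without logarithmic data, with "Thm. 4.1.1 applies to `Y`" as an explicit hypothesis. Data, in
order: `K/k` finitely generated; `O = K° ⊇ k`; the intermediate field `k̄`, finitely generated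
over `k`, with `Ok̄ = K° ∩ k̄` of height `≤ 1` and `Temkin2013DescentFor k k̄ Ok̄`; an affine
`k`-model `Y = Spec B` of `Ok̄` inside `k̄`; a NORMAL affine model `X = Spec A` of `K°` containing
the image of `B`; a finite extension of valued fields `(K₁, O₁)/(K, O)`; a finite extension of
valued fields `(m, Om)/(k̄, Ok̄)`; and — with `X₁S = Nr_{K₁}(X ×_Y Spec k̄°)`, i.e.
`etaModel k̄ (Nr_{K₁}(A)) k̄°`, which lies in `O₁` — the smooth-equivalence over `k̄°` of the
centre of `O₁` on `X₁S` with the closed point of `Spec m°`. Conclusion: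
`Temkin2013DescentConclusion k K O A K₁ O₁`. (The announced proof from `Temkin2013_Lemma284`,
`Temkin2013_Lemma285_normal` — the corrected rendering of Lemma 2.8.5, not the refuted
`Temkin2013_Lemma285` —, `Stacks05B5` and `Temkin2013_valuationRingOpen` has been carried out
for the corrected rendering: `Temkin2013_Steps34_tower_holds`.)
[cite: Temkin2013, proof of Thm. 4.1.1, Steps 3–4 (arXiv:0804.1554v3 pp. 48–49) and Section 4.2, Step 2 (p. 51)] -/
@[deprecated "MIS-RENDERED (the binders `[Algebra kb K₁] [IsScalarTower kb K K₁]` leave the kb-structure of K₁ arbitrary, the tower hypothesis being the automatic one for the action inherited from K): use the corrected rendering Literature.AlgebraicGeometry.Resolution.Temkin2013_Steps34_tower (InseparableLocalUniformizationEngineTower.lean), PROVED as Literature.AlgebraicGeometry.Resolution.Temkin2013_Steps34_tower_holds (InseparableLocalUniformizationStepsThreeFourHolds.lean)" (since := "2026-08-16")]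
def Temkin2013_Steps34 : Prop :=
  ∀ (k K : Type u) [Field k] [Field K] [Algebra k K], (⊤ : IntermediateField k K).FG →
  ∀ (O : ValuationSubring K), (∀ c : k, algebraMap k K c ∈ O) →
  ∀ (kb : IntermediateField k K), (⊤ : IntermediateField k kb).FG →
    ringKrullDim (O.comap (algebraMap kb K)) ≤ 1 →
    Temkin2013DescentFor k kb (O.comap (algebraMap kb K)) →
  ∀ (B : Subalgebra k kb), B.toSubring ≤ (O.comap (algebraMap kb K)).toSubring → B.FG →
    IsFractionRing B kb →
  ∀ (A : Subalgebra k K), A.toSubring ≤ O.toSubring → A.FG → IsFractionRing A K →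
    (∀ x : K, IsIntegral A x → x ∈ A) → (∀ b : B, algebraMap kb K b ∈ A) →
  ∀ (K₁ : Type u) [Field K₁] [Algebra K K₁] [Algebra kb K₁] [IsScalarTower kb K K₁],
    FiniteDimensional K K₁ →
  ∀ (O₁ : ValuationSubring K₁), O₁.comap (algebraMap K K₁) = O →
  ∀ (m : Type u) [Field m] [Algebra kb m], FiniteDimensional kb m →
  ∀ (Om : ValuationSubring m), Om.comap (algebraMap kb m) = O.comap (algebraMap kb K) →
  ∀ (hXS : etaModel kb (nrIn (A.toSubring.map (algebraMap K K₁)))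
      (O.comap (algebraMap kb K)).toSubring ≤ O₁.toSubring)
    (hOm : ∀ c : (O.comap (algebraMap kb K)).toSubring, algebraMap kb m c ∈ Om),
    AreSmoothEquivalent
      (etaModelBaseMap (nrIn (A.toSubring.map (algebraMap K K₁)))
        (O.comap (algebraMap kb K)).toSubring)
      (((algebraMap kb m).comp (O.comap (algebraMap kb K)).toSubring.subtype).codRestrict Om hOm)
      ((IsLocalRing.maximalIdeal O₁).comap (Subring.inclusion hXS))
      (IsLocalRing.maximalIdeal Om) →
    Temkin2013DescentConclusion k K O A K₁ O₁

end Literature.AlgebraicGeometry.Resolution
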